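import Summits.KontsevichZagierPeriods.KontsevichZagierPeriods.Theorems.SoloBlindBoxBasis
import Summits.KontsevichZagierPeriods.KontsevichZagierPeriods.Theorems.SoloBlindBoxTranscendence
import HarnessLib

/-!
# The box sector of the Kontsevich–Zagier conjecture, V: the kernel theorem

**Theorem (box sector of Kontsevich–Zagier's period conjecture, conditional on the algebraic
independence of logarithms).**  Let `B ⊆ FormalRep` be the *box ring*: the subring generated by
the rational integral representations of dimension `≤ 1` — all `ℤ`-combinations of Fubini
products `[σ₁ × ⋯ × σ_k, f₁ ⋯ f_k]` of absolutely convergent integrals `∫_{σ_i} f_i` of rational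
functions with rational coefficients over rational intervals / points (`SoloBlindBoxGenerators`).
Assume `AlgIndepLogarithms`.  Then an element of `B` whose value (sum of integrals) is `0` is a
consequence of the three Kontsevich–Zagier moves (`boxRing_kernel`); equivalently, two elements of
`B` — in particular two Fubini products of rational one-dimensional integrals, of any dimensions —
with the same period are equivalent under the moves (`kz_boxRing`, `kz_prod_prod`).

Unconditionally the tree has the dimension-`≤ 1` case (`SoloBlindDimLeOne.kz_dim_le_one`, via
Baker's theorem); the box sector is the part of the conjecture in which the periods are the
polynomials in `1`, `log μ`, `arctan t` (`μ, t` real algebraic) — e.g. `log 2 · log 3`,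
`π² / 16 = (arctan 1)²`, `π log 2` — and the theorem says that there the *only* obstruction to
Kontsevich–Zagier's conjecture is the expected transcendence statement: no further geometric
relation is missing from the three moves.

Proof: the class of `z ∈ B` in the formal period ring `Q = FormalRep ⧸ relations` is a
`K₀`-polynomial in independent unit cells `ℓ(u_k)`, `a(θ_k)` (`SoloBlindBoxBasis`); evaluating,
`eval z = 0` is a `K₀`-algebraic relation among `log u_k`, `arctan θ_k`, which are algebraically
independent over `K₀` under `AlgIndepLogarithms` (`SoloBlindBoxTranscendence`); so the polynomial
is `0` and `z ∈ relations`.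

References: M. Kontsevich, D. Zagier, *Periods* (2001), §1.2 (the conjecture), §1.1 (examples);
M. Waldschmidt, *Diophantine approximation on linear algebraic groups* (2000), Conj. 1.15.
-/

noncomputable section

open scoped BigOperators

namespace Summit.KontsevichZagierPeriods.KontsevichZagierPeriods.Theorems

open Literature.NumberTheory.Transcendental
open Literature.NumberTheory.Transcendental.KZ
open Literature.Barriers.Schanuel (AlgIndepLogarithms)

namespace SoloBlind

/-- Evaluating the unit-cell family gives the real box family. -/
theorem evalAlgHom_boxGen {κ κ' : Type} (u : κ → ℝ) (θ : κ' → ℝ)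
    (hu : ∀ k, IsAlgebraic ℚ (u k) ∧ 1 < u k) (hθ : ∀ k, IsAlgebraic ℚ (θ k) ∧ 0 < θ k) :
    (fun m => evalAlgHom (boxGen u θ m)) = boxFamily u θ := by
  funext m
  rcases m with k | k
  · rw [boxGen_inl, boxFamily_inl, evalAlgHom_apply, evalQ_ell (hu k).1 (hu k).2.le]
  · rw [boxGen_inr, boxFamily_inr, evalAlgHom_apply, evalQ_alpha (hθ k).1 (hθ k).2.le]

/-- **The box-sector kernel theorem.**  Under `AlgIndepLogarithms`, an element of the box ring
with value `0` is a consequence of the Kontsevich–Zagier moves. -/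
theorem boxRing_kernel (h : AlgIndepLogarithms) {z : FormalRep} (hz : z ∈ boxRing)
    (h0 : eval z = 0) : z ∈ relations := by
  obtain ⟨κ, κ', _, _, u, θ, hu, hθ, hli, hli', hmem⟩ := exists_basis_of_mem_boxRing hz
  rw [Algebra.adjoin_range_eq_range_aeval, AlgHom.mem_range] at hmem
  obtain ⟨p, hp⟩ := hmem
  -- evaluating: `p(log u, arctan θ) = eval z = 0`
  have hp0 : MvPolynomial.aeval (boxFamily u θ) p = 0 := by
    have h1 := congrArg evalAlgHom hp
    rw [evalAlgHom_mkQ, h0, ← AlgHom.comp_apply, MvPolynomial.comp_aeval,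
      evalAlgHom_boxGen u θ hu hθ] at h1
    exact h1
  -- transcendence: `p = 0`
  have hind := algebraicIndependent_boxFamily h u θ hu (fun k => (hθ k).1) hli hli'
  have hp' : p = 0 := (algebraicIndependent_iff.mp hind) p hp0
  rw [← mkQ_eq_zero_iff, ← hp, hp', map_zero]

/-- **The Kontsevich–Zagier conjecture on the box ring (conditional form).**  Under
`AlgIndepLogarithms`, two integral representations lying in the box ring and having the same
period are equivalent under the Kontsevich–Zagier moves. -/
theorem kz_boxRing (h : AlgIndepLogarithms) {n m : ℕ} (r : IntegralRep n) (r' : IntegralRep m)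
    (hr : of r ∈ boxRing) (hr' : of r' ∈ boxRing) (hv : r.value = r'.value) :
    Equivalent r r' :=
  boxRing_kernel h (sub_mem hr hr') (by rw [map_sub, eval_of, eval_of, hv, sub_self])

/-- A Fubini product of two rational representations of dimension `≤ 1` lies in the box ring. -/
theorem of_prod_mem_boxRing {n m : ℕ} (r : IntegralRep n) (s : IntegralRep m) (hn : n ≤ 1)
    (hm : m ≤ 1) (hr : r.IsRational) (hs : s.IsRational) : of (r.prod s) ∈ boxRing := by
  rw [← of_mul_of]
  exact mul_mem (of_mem_boxRing r hn hr) (of_mem_boxRing s hm hs)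

/-- The box ring is closed under Fubini products of representations. -/
theorem of_prod_mem_boxRing_of_mem {n m : ℕ} {r : IntegralRep n} {s : IntegralRep m}
    (hr : of r ∈ boxRing) (hs : of s ∈ boxRing) : of (r.prod s) ∈ boxRing := by
  rw [← of_mul_of]
  exact mul_mem hr hs

/-- **Products of one-dimensional rational integrals (conditional form).**  Under
`AlgIndepLogarithms`: if `∫_{σ₁} f₁ · ∫_{σ₂} f₂ = ∫_{τ₁} g₁ · ∫_{τ₂} g₂` for rational integral
representations `[σ_i, f_i]`, `[τ_j, g_j]` of dimension `≤ 1`, then the Fubini products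
`[σ₁ × σ₂, f₁ f₂]` and `[τ₁ × τ₂, g₁ g₂]` are equivalent under the Kontsevich–Zagier moves. -/
theorem kz_prod_prod (h : AlgIndepLogarithms) {n₁ n₂ m₁ m₂ : ℕ} (r₁ : IntegralRep n₁)
    (r₂ : IntegralRep n₂) (s₁ : IntegralRep m₁) (s₂ : IntegralRep m₂) (hn₁ : n₁ ≤ 1)
    (hn₂ : n₂ ≤ 1) (hm₁ : m₁ ≤ 1) (hm₂ : m₂ ≤ 1) (hr₁ : r₁.IsRational) (hr₂ : r₂.IsRational)
    (hs₁ : s₁.IsRational) (hs₂ : s₂.IsRational)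
    (hv : r₁.value * r₂.value = s₁.value * s₂.value) :
    Equivalent (r₁.prod r₂) (s₁.prod s₂) :=
  kz_boxRing h _ _ (of_prod_mem_boxRing r₁ r₂ hn₁ hn₂ hr₁ hr₂)
    (of_prod_mem_boxRing s₁ s₂ hm₁ hm₂ hs₁ hs₂)
    (by rw [IntegralRep.value_prod, IntegralRep.value_prod, hv])

/-- **A product against a single integral (conditional form).**  Under `AlgIndepLogarithms`: if
`∫_{σ₁} f₁ · ∫_{σ₂} f₂ = ∫_τ g` for rational representations of dimension `≤ 1`, then
`[σ₁ × σ₂, f₁ f₂]` and `[τ, g]` are equivalent under the Kontsevich–Zagier moves. -/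
theorem kz_prod_single (h : AlgIndepLogarithms) {n₁ n₂ m : ℕ} (r₁ : IntegralRep n₁)
    (r₂ : IntegralRep n₂) (s : IntegralRep m) (hn₁ : n₁ ≤ 1) (hn₂ : n₂ ≤ 1) (hm : m ≤ 1)
    (hr₁ : r₁.IsRational) (hr₂ : r₂.IsRational) (hs : s.IsRational)
    (hv : r₁.value * r₂.value = s.value) : Equivalent (r₁.prod r₂) s :=
  kz_boxRing h _ _ (of_prod_mem_boxRing r₁ r₂ hn₁ hn₂ hr₁ hr₂) (of_mem_boxRing s hm hs)
    (by rw [IntegralRep.value_prod, hv])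

/-- **Triple products (conditional form).**  Under `AlgIndepLogarithms`, two threefold Fubini
products of rational representations of dimension `≤ 1` with the same value are equivalent. -/
theorem kz_prod₃ (h : AlgIndepLogarithms) {n₁ n₂ n₃ m₁ m₂ m₃ : ℕ} (r₁ : IntegralRep n₁)
    (r₂ : IntegralRep n₂) (r₃ : IntegralRep n₃) (s₁ : IntegralRep m₁) (s₂ : IntegralRep m₂)
    (s₃ : IntegralRep m₃) (hn₁ : n₁ ≤ 1) (hn₂ : n₂ ≤ 1) (hn₃ : n₃ ≤ 1) (hm₁ : m₁ ≤ 1)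
    (hm₂ : m₂ ≤ 1) (hm₃ : m₃ ≤ 1) (hr₁ : r₁.IsRational) (hr₂ : r₂.IsRational)
    (hr₃ : r₃.IsRational) (hs₁ : s₁.IsRational) (hs₂ : s₂.IsRational) (hs₃ : s₃.IsRational)
    (hv : r₁.value * r₂.value * r₃.value = s₁.value * s₂.value * s₃.value) :
    Equivalent ((r₁.prod r₂).prod r₃) ((s₁.prod s₂).prod s₃) :=
  kz_boxRing h _ _
    (of_prod_mem_boxRing_of_mem (of_prod_mem_boxRing r₁ r₂ hn₁ hn₂ hr₁ hr₂)
      (of_mem_boxRing r₃ hn₃ hr₃))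
    (of_prod_mem_boxRing_of_mem (of_prod_mem_boxRing s₁ s₂ hm₁ hm₂ hs₁ hs₂)
      (of_mem_boxRing s₃ hm₃ hs₃))
    (by simp only [IntegralRep.value_prod]; rw [hv])

/-- **The dimension-`≤ 1` case is contained in the box sector** (sanity check of the frame; the
unconditional theorem is `SoloBlindDimLeOne.kz_dim_le_one`). -/
theorem kz_dim_le_one_of_algIndep (h : AlgIndepLogarithms) {n m : ℕ} (r : IntegralRep n)
    (r' : IntegralRep m) (hn : n ≤ 1) (hm : m ≤ 1) (hr : r.IsRational) (hr' : r'.IsRational)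
    (hv : r.value = r'.value) : Equivalent r r' :=
  kz_boxRing h r r' (of_mem_boxRing r hn hr) (of_mem_boxRing r' hm hr') hv

end SoloBlind

end Summit.KontsevichZagierPeriods.KontsevichZagierPeriods.Theorems
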